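import Literature.AlgebraicGeometry.Motives.AbelianVarietyCotangent
import Literature.AlgebraicGeometry.Motives.AbelianVarietyBaseChange
import Literature.AlgebraicGeometry.Motives.AbelianVarietyFrobeniusKernel
import Mathlib.RingTheory.TensorProduct.Free
import Mathlib.LinearAlgebra.Dimension.Constructions
import HarnessLib

/-!
# Base change of the cotangent space of an abelian variety, I: the map `L ⊗_K T_e^*(A) → T_e^*(A_L)`

Let `A` be an abelian variety over a field `K`, `L ⊇ K` a field extension and `A_L = A ×_K Spec L`
its base change (`AbelianVariety.baseChange`, `Motives/AbelianVarietyProjective`), with projection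
`pr : A_L → A` (`bcFst`, `Motives/AbelianVarietyFrobeniusTwist`). The cotangent space
`T_e^*(A) = 𝔪_e/𝔪_e²` is the `K`-vector space `AbelianVariety.Cotangent A` of
`Motives/AbelianVarietyCotangent`, with the contravariant action `cotangentMap A u` of endomorphisms.
This file constructs the **base-change map**

* `AbelianVariety.cotangentBaseChangeMap L A : L ⊗[K] Cotangent A →ₗ[L] Cotangent (A.baseChange L)`,
  `c ⊗ dā ↦ c · d(pr^* a)`, the `L`-linear extension of the map induced on `𝔪/𝔪²` by the local
  homomorphism `pr^* : 𝒪_{A,e} → 𝒪_{A_L,e}` (`stalkMapFst`; `pr(e_{A_L}) = e_A`, `bcFst_base_origin`),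
  i.e. the map (6.6.2)/(6.6.3) of Görtz–Wedhorn, *Algebraic Geometry I*, Remark 6.12 (2)–(3)
  (p. 188), written on cotangent spaces;
* its **naturality in the endomorphism**, `cotangentBaseChangeMap_comp_baseChange_cotangentMap`:
  `Φ ∘ (1 ⊗ T_e^*(u)) = T_e^*(u_L) ∘ Φ` for `u : A → A` and its base change `u_L = Hom.baseChange L u`
  (`Motives/AbelianVarietyBaseChange`), from `(u_L)^* ∘ pr^* = pr^* ∘ u^*` (`u_L ≫ pr = pr ≫ u`);
* the **`L`-valued tangent vectors** `tangentHomL ψ : 𝒪_{A,e} → L[ε]`, `a ↦ a(e) + ψ(dā) ε`, attached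
  to `K`-linear maps `ψ : T_e^*(A) → L` (Görtz–Wedhorn I, (6.4), Prop. 6.7: tangent vectors as
  `k[ε]`-valued points; here with values in `L[ε]`, as in Remark 6.12 (2)), the tool by which the
  sequel `Motives/AbelianVarietyCotangentBaseChangeIso` proves that the base-change map is an
  isomorphism.

Everything is proved (no named facts). The `K`-algebra structures on `𝒪_{A,e}`, `𝒪_{A_L,e}` and
the `K`-module structure on `T_e^*(A_L)` are *local* instances (`stalkOriginAlgebra`,
`stalkOriginAlgebraOfBase`, `Cotangent.moduleOfBase`), definitionally those of `AbelianVarietyCotangent`.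

## References

* U. Görtz, T. Wedhorn, *Algebraic Geometry I: Schemes*, 2nd ed. (2020), (6.4), Prop. 6.7,
  Remark 6.12 (1)–(3) with (6.6.2)–(6.6.3) (pp. 184–188). [GortzWedhorn2020]
-/

universe u
open CategoryTheory CategoryTheory.Limits AlgebraicGeometry IsLocalRing TensorProduct

noncomputable section

namespace Literature.AlgebraicGeometry.Motives

namespace AbelianVariety

open scoped MonObj
open AlgPoints

variable {K : Type u} [Field K] (L : Type u) [Field L] [Algebra K L] (A : AbelianVariety K)

/-! ### The local `K`-algebra `𝒪_{A,e}` (local instance) and points at the origin -/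

/-- The `K`-algebra structure `K → 𝒪_{A,e}` of the local ring at the origin
(`stalkOriginAlgebraMap`), as a *local* instance for this file (the library keeps it a `letI`, cf.
`Cotangent.instModule`). [folklore] -/
@[reducible]
def stalkOriginAlgebra : Algebra K (stalkOrigin A) := (stalkOriginAlgebraMap A).toAlgebra

attribute [local instance] stalkOriginAlgebra

variable {A} in
/-- Two local homomorphisms `𝒪_{A,e} → R` defining the same point `Spec R → A` are equal
(`evAt_ptOfStalkHom`).
[cite: StacksProject, Tag 01J7 (Lemma 26.13.3: morphisms from spectra of local rings)] -/
theorem eq_of_ptOfStalkHom_eq {R : CommRingCat.{u}} [IsLocalRing R] {g g' : stalkOrigin A ⟶ R}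
    [IsLocalHom g.hom] [IsLocalHom g'.hom] (h : ptOfStalkHom g = ptOfStalkHom g') : g = g' := by
  rw [← evAt_ptOfStalkHom g (ptOfStalkHom_closedPoint g),
    ← evAt_ptOfStalkHom g' (ptOfStalkHom_closedPoint g')]
  exact evAt_congr h _ _

/-! ### The projection `A_L → A` at the origin -/

/-- The projection `A_L → A` maps the origin to the origin (the unit section of `A_L` is the base
change of that of `A`; `pointsMulEquiv`).
[cite: GortzWedhorn2020, Remark 6.3 (3) and Remark 6.12 (2)–(3), (6.6.2)–(6.6.3) (p. 188)] -/
theorem bcFst_base_origin : (bcFst L A).base (origin (A.baseChange L)) = origin A := by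
  have h1 : (1 : (A.baseChange L).Points L).left ≫ bcFst L A = (1 : A.Points L).left := by
    have h := pointsEquiv_apply_left_comp_fst (L := L) A 1
    rwa [← pointsMulEquiv_apply, map_one, ← bcFst_def] at h
  have h0 : origin (A.baseChange L) =
      (1 : (A.baseChange L).Points L).left.base (IsLocalRing.closedPoint L) :=
    (one_left_base _).symm
  rw [h0, ← Scheme.Hom.comp_apply, h1]
  exact one_left_base _

/-- **`pr^* : 𝒪_{A,e} → 𝒪_{A_L,e}`**, the local homomorphism of the projection `A_L → A` at the
origin (its stalk map at `e_{A_L}`, transported along `pr(e_{A_L}) = e_A`). [folklore] -/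
def stalkMapFst : stalkOrigin A ⟶ stalkOrigin (A.baseChange L) :=
  (A.X.left.presheaf.stalkCongr (.of_eq (bcFst_base_origin L A))).inv ≫
    (bcFst L A).stalkMap (origin (A.baseChange L))

/-- `pr^*` is a local homomorphism. [folklore] -/
instance isLocalHom_stalkMapFst : IsLocalHom (stalkMapFst L A).hom := by
  unfold stalkMapFst
  rw [CommRingCat.hom_comp]
  haveI := isLocalHom_of_isIso
    (A.X.left.presheaf.stalkCongr (.of_eq (bcFst_base_origin L A))).inv
  infer_instance

/-- `pr^*` maps `𝔪_{A,e}` into `𝔪_{A_L,e}`.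
[cite: GortzWedhorn2020, Remark 6.3 (3) and Remark 6.12 (2)–(3), (6.6.2)–(6.6.3) (p. 188)] -/
theorem stalkMapFst_mem {x : stalkOrigin A} (hx : x ∈ maximalIdeal (stalkOrigin A)) :
    stalkMapFst L A x ∈ maximalIdeal (stalkOrigin (A.baseChange L)) :=
  map_nonunit (stalkMapFst L A).hom x hx

/-- `pr^*` is compatible with the structure maps: `pr^*(c) = c` for `c ∈ K ⊆ L`
(`A_L → A` covers `Spec L → Spec K`).
[cite: GortzWedhorn2020, Remark 6.3 (3) and Remark 6.12 (2)–(3), (6.6.2)–(6.6.3) (p. 188)] -/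
theorem stalkMapFst_algebraMap (c : K) :
    stalkMapFst L A (stalkOriginAlgebraMap A c) =
      stalkOriginAlgebraMap (A.baseChange L) (algebraMap K L c) := by
  rw [stalkOriginAlgebraMap_apply, stalkOriginAlgebraMap_apply, stalkMapFst, CommRingCat.comp_apply]
  have h1 : (A.X.left.presheaf.stalkCongr (.of_eq (bcFst_base_origin L A))).inv
        (A.X.left.presheaf.germ ⊤ (origin A) trivial
          (A.X.hom.appTop ((Scheme.ΓSpecIso (.of K)).inv c))) =
      A.X.left.presheaf.germ ⊤ ((bcFst L A).base (origin (A.baseChange L))) trivial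
        (A.X.hom.appTop ((Scheme.ΓSpecIso (.of K)).inv c)) := by
    rw [TopCat.Presheaf.stalkCongr_inv]
    exact TopCat.Presheaf.germ_stalkSpecializes_apply _ _ _ _
  have h2 : (Scheme.ΓSpecIso (.of L)).inv (algebraMap K L c) =
      (bcSpec K L).appTop ((Scheme.ΓSpecIso (.of K)).inv c) := by
    change ((CommRingCat.ofHom (algebraMap K L)) ≫ (Scheme.ΓSpecIso (.of L)).inv) c = _
    rw [Scheme.ΓSpecIso_inv_naturality]
    rfl
  rw [h1, Scheme.Hom.germ_stalkMap_apply, h2]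
  exact congrArg (fun g : (A.baseChange L).X.left ⟶ Spec (.of K) =>
    (A.baseChange L).X.left.presheaf.germ ⊤ (origin (A.baseChange L)) trivial
      (g.appTop ((Scheme.ΓSpecIso (.of K)).inv c))) (bcFst_comp_hom L A)

/-- **Functoriality of points along the projection:** `Spec R → A_L → A` is the point of
`pr^* ≫ g` (cf. `ptOfStalkHom_comp_toSchemeHom`).
[cite: StacksProject, Tag 01J7 (Lemma 26.13.3: morphisms from spectra of local rings)] -/
theorem ptOfStalkHom_comp_bcFst {R : CommRingCat.{u}} (g : stalkOrigin (A.baseChange L) ⟶ R) :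
    ptOfStalkHom g ≫ bcFst L A = ptOfStalkHom (stalkMapFst L A ≫ g) := by
  rw [ptOfStalkHom, ptOfStalkHom, stalkMapFst, Category.assoc,
    ← Scheme.SpecMap_stalkMap_fromSpecStalk, TopCat.Presheaf.stalkCongr_inv,
    ← Scheme.SpecMap_stalkSpecializes_fromSpecStalk
      (specializes_of_eq (bcFst_base_origin L A)),
    Spec.map_comp, Spec.map_comp, Category.assoc, Category.assoc]

variable {A} in
/-- **`pr^*` intertwines `u^*` and `(u_L)^*`:** `(u_L)^* ∘ pr^* = pr^* ∘ u^*` on `𝒪_{A,e}`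
(from `u_L ≫ pr = pr ≫ u`, `toSchemeHom_baseChange_comp_fst`).
[cite: GortzWedhorn2020, Remark 6.3 (3) and Remark 6.12 (2)–(3), (6.6.2)–(6.6.3) (p. 188)] -/
theorem stalkMapFst_comp_stalkMapEnd_baseChange (u : A ⟶ A) :
    stalkMapFst L A ≫ stalkMapEnd (A.baseChange L) (Hom.baseChange L u) =
      stalkMapEnd A u ≫ stalkMapFst L A := by
  haveI : IsLocalHom (CommRingCat.Hom.hom (𝟙 (stalkOrigin (A.baseChange L)))) := by
    rw [CommRingCat.hom_id]; infer_instance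
  haveI : IsLocalHom
      (CommRingCat.Hom.hom (stalkMapFst L A ≫ stalkMapEnd (A.baseChange L) (Hom.baseChange L u))) := by
    rw [CommRingCat.hom_comp]; infer_instance
  haveI : IsLocalHom (CommRingCat.Hom.hom (stalkMapEnd A u ≫ stalkMapFst L A)) := by
    rw [CommRingCat.hom_comp]; infer_instance
  apply eq_of_ptOfStalkHom_eq
  have e1 : ptOfStalkHom (stalkMapFst L A ≫ stalkMapEnd (A.baseChange L) (Hom.baseChange L u)) =
      ptOfStalkHom (𝟙 (stalkOrigin (A.baseChange L))) ≫
        Hom.toSchemeHom (Hom.baseChange L u) ≫ bcFst L A := by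
    rw [← Category.assoc, ptOfStalkHom_comp_toSchemeHom, Category.comp_id, ptOfStalkHom_comp_bcFst]
  have e2 : ptOfStalkHom (stalkMapEnd A u ≫ stalkMapFst L A) =
      ptOfStalkHom (𝟙 (stalkOrigin (A.baseChange L))) ≫ bcFst L A ≫ Hom.toSchemeHom u := by
    rw [← Category.assoc, ptOfStalkHom_comp_bcFst, Category.comp_id, ptOfStalkHom_comp_toSchemeHom]
  rw [e1, e2, toSchemeHom_baseChange_comp_bcFst]

variable {A} in
/-- Pointwise form of `stalkMapFst_comp_stalkMapEnd_baseChange`.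
[cite: GortzWedhorn2020, Remark 6.3 (3) and Remark 6.12 (2)–(3), (6.6.2)–(6.6.3) (p. 188)] -/
theorem stalkMapEnd_baseChange_stalkMapFst (u : A ⟶ A) (a : stalkOrigin A) :
    stalkMapEnd (A.baseChange L) (Hom.baseChange L u) (stalkMapFst L A a) =
      stalkMapFst L A (stalkMapEnd A u a) := by
  rw [← CommRingCat.comp_apply, stalkMapFst_comp_stalkMapEnd_baseChange, CommRingCat.comp_apply]

/-! ### The `K`-structures on `𝒪_{A_L,e}` and `T_e^*(A_L)` -/

/-- The `K`-algebra structure `K → L → 𝒪_{A_L,e}` (local instance). [folklore] -/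
@[reducible]
def stalkOriginAlgebraOfBase : Algebra K (stalkOrigin (A.baseChange L)) :=
  ((stalkOriginAlgebraMap (A.baseChange L)).comp (algebraMap K L)).toAlgebra

attribute [local instance] stalkOriginAlgebraOfBase

/-- `K → L → 𝒪_{A_L,e}` is a scalar tower. [folklore] -/
instance isScalarTower_stalkOrigin_baseChange :
    IsScalarTower K L (stalkOrigin (A.baseChange L)) :=
  IsScalarTower.of_algebraMap_eq fun _ => rfl

/-- The `K`-vector space structure of `T_e^*(A_L)` obtained by restricting its `L`-structure
(local instance). [folklore] -/
@[reducible]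
def Cotangent.moduleOfBase : Module K (Cotangent (A.baseChange L)) :=
  inferInstanceAs (Module K (CotangentSpace (stalkOrigin (A.baseChange L))))

attribute [local instance] Cotangent.moduleOfBase

/-- `K → L → T_e^*(A_L)` is a scalar tower. [folklore] -/
instance Cotangent.isScalarTower_of_base : IsScalarTower K L (Cotangent (A.baseChange L)) :=
  inferInstanceAs (IsScalarTower K L (CotangentSpace (stalkOrigin (A.baseChange L))))

/-- `pr^*` as a `K`-algebra map `𝒪_{A,e} → 𝒪_{A_L,e}`. [folklore] -/
def stalkMapFstAlgHom : stalkOrigin A →ₐ[K] stalkOrigin (A.baseChange L) :=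
  { (stalkMapFst L A).hom with commutes' := fun c => stalkMapFst_algebraMap L A c }

/-- Unfolding of `stalkMapFstAlgHom`.
[cite: GortzWedhorn2020, Remark 6.3 (3) and Remark 6.12 (2)–(3), (6.6.2)–(6.6.3) (p. 188)] -/
@[simp]
theorem stalkMapFstAlgHom_apply (a : stalkOrigin A) : stalkMapFstAlgHom L A a = stalkMapFst L A a :=
  rfl

/-! ### The base-change map `L ⊗_K T_e^*(A) → T_e^*(A_L)` -/

/-- The `K`-linear map `T_e^*(A) → T_e^*(A_L)` induced by `pr^*` on `𝔪/𝔪²`. [folklore] -/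
def cotangentToBaseChange : Cotangent A →ₗ[K] Cotangent (A.baseChange L) :=
  Ideal.mapCotangent (maximalIdeal (stalkOrigin A)) (maximalIdeal (stalkOrigin (A.baseChange L)))
    (stalkMapFstAlgHom L A) (fun _ hx => stalkMapFst_mem L A hx)

/-- `T_e^*(pr)(da) = d(pr^* a)`.
[cite: GortzWedhorn2020, Remark 6.3 (3) and Remark 6.12 (2)–(3), (6.6.2)–(6.6.3) (p. 188)] -/
@[simp]
theorem cotangentToBaseChange_mk (x : ↥(maximalIdeal (stalkOrigin A))) :
    cotangentToBaseChange L A (Cotangent.mk A x) =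
      Cotangent.mk (A.baseChange L) ⟨stalkMapFst L A x, stalkMapFst_mem L A x.2⟩ :=
  rfl

/-- **The base-change map `L ⊗_K T_e^*(A) → T_e^*(A_L)`**, `c ⊗ da ↦ c · d(pr^* a)`: the
`L`-linear extension of `T_e^*(pr)` (Görtz–Wedhorn I, Remark 6.12 (2)–(3), the map (6.6.2)).
[cite: GortzWedhorn2020, Remark 6.12 (2)–(3), (6.6.2)–(6.6.3) (p. 188)] -/
def cotangentBaseChangeMap : L ⊗[K] Cotangent A →ₗ[L] Cotangent (A.baseChange L) :=
  (cotangentToBaseChange L A).liftBaseChange L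

/-- `Φ (c ⊗ da) = c · d(pr^* a)`.
[cite: GortzWedhorn2020, Remark 6.3 (3) and Remark 6.12 (2)–(3), (6.6.2)–(6.6.3) (p. 188)] -/
@[simp]
theorem cotangentBaseChangeMap_tmul (c : L) (v : Cotangent A) :
    cotangentBaseChangeMap L A (c ⊗ₜ v) = c • cotangentToBaseChange L A v :=
  LinearMap.liftBaseChange_tmul L _ c v

variable {A} in
/-- **Naturality of the base-change map in the endomorphism:**
`Φ ∘ (1 ⊗ T_e^*(u)) = T_e^*(u_L) ∘ Φ` (`(u_L)^* ∘ pr^* = pr^* ∘ u^*`).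
[cite: GortzWedhorn2020, Remark 6.3 (3) and Remark 6.12 (2)–(3), (6.6.2)–(6.6.3) (p. 188)] -/
theorem cotangentBaseChangeMap_comp_baseChange_cotangentMap (u : A ⟶ A) :
    cotangentBaseChangeMap L A ∘ₗ (cotangentMap A u).baseChange L =
      cotangentMap (A.baseChange L) (Hom.baseChange L u) ∘ₗ cotangentBaseChangeMap L A := by
  apply TensorProduct.AlgebraTensorModule.ext
  intro c v
  obtain ⟨x, rfl⟩ := Cotangent.mk_surjective v
  simp only [LinearMap.comp_apply, LinearMap.baseChange_tmul, cotangentBaseChangeMap_tmul,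
    cotangentMap_mk, cotangentToBaseChange_mk, _root_.map_smul]
  have key : ∀ p q, (⟨stalkMapFst L A (stalkMapEnd A u x), p⟩ :
      ↥(maximalIdeal (stalkOrigin (A.baseChange L)))) =
        ⟨stalkMapEnd (A.baseChange L) (Hom.baseChange L u) (stalkMapFst L A x), q⟩ :=
    fun p q => Subtype.ext (stalkMapEnd_baseChange_stalkMapFst L u x).symm
  rw [key]

/-! ### `L`-valued tangent vectors of `A`: local `K`-algebra maps `𝒪_{A,e} → L[ε]` -/

section TangentL

open TrivSqZeroExt

variable {L A}
variable (ψ : Cotangent A →ₗ[K] L)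

/-- `d a ∈ 𝔪_e`: the element `a - a(e)` of `𝔪_e` whose class is the differential of `a` at `e`.
[folklore] -/
def dOrigin (a : stalkOrigin A) : ↥(maximalIdeal (stalkOrigin A)) :=
  ⟨a - stalkOriginAlgebraMap A (evalOrigin A a), sub_algebraMap_evalOrigin_mem A a⟩

/-- Unfolding of `dOrigin`.
[cite: GortzWedhorn2020, (6.4) and Proposition 6.7 (p. 184), Remark 6.12 (2) (p. 188)] -/
@[simp]
theorem coe_dOrigin (a : stalkOrigin A) :
    (dOrigin a : stalkOrigin A) = a - stalkOriginAlgebraMap A (evalOrigin A a) := rfl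

/-- The `L`-valued point derivation `a ↦ ψ(da(e))` of a `K`-linear map `ψ : T_e^*(A) → L`. [folklore] -/
def tangentFormL (a : stalkOrigin A) : L := ψ (Cotangent.mk A (dOrigin a))

/-- `tangentFormL ψ` is additive.
[cite: GortzWedhorn2020, (6.4) and Proposition 6.7 (p. 184), Remark 6.12 (2) (p. 188)] -/
theorem tangentFormL_add (a b : stalkOrigin A) :
    tangentFormL ψ (a + b) = tangentFormL ψ a + tangentFormL ψ b := by
  rw [tangentFormL, tangentFormL, tangentFormL, ← map_add, ← map_add]
  congr 2
  ext
  simp only [coe_dOrigin, map_add, Submodule.coe_add]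
  ring

/-- `tangentFormL ψ` is `K`-linear for the scalars `K → 𝒪_{A,e}`.
[cite: GortzWedhorn2020, (6.4) and Proposition 6.7 (p. 184), Remark 6.12 (2) (p. 188)] -/
theorem tangentFormL_smul (c : K) (a : stalkOrigin A) :
    tangentFormL ψ (stalkOriginAlgebraMap A c * a) = c • tangentFormL ψ a := by
  rw [tangentFormL, tangentFormL, ← _root_.map_smul, Cotangent.smul_mk]
  congr 2
  ext
  change stalkOriginAlgebraMap A c * a -
      stalkOriginAlgebraMap A (evalOrigin A (stalkOriginAlgebraMap A c * a)) =
    stalkOriginAlgebraMap A c * (a - stalkOriginAlgebraMap A (evalOrigin A a))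
  rw [map_mul, evalOrigin_algebraMap, map_mul, mul_sub]

/-- `tangentFormL ψ` kills the constants.
[cite: GortzWedhorn2020, (6.4) and Proposition 6.7 (p. 184), Remark 6.12 (2) (p. 188)] -/
theorem tangentFormL_algebraMap (c : K) : tangentFormL ψ (stalkOriginAlgebraMap A c) = 0 := by
  have h : dOrigin (stalkOriginAlgebraMap A c) = 0 := by
    ext; rw [coe_dOrigin, evalOrigin_algebraMap, sub_self]; rfl
  rw [tangentFormL, h, map_zero, map_zero]

/-- On `𝔪_e`, `tangentFormL ψ` is `ψ ∘ d`.
[cite: GortzWedhorn2020, (6.4) and Proposition 6.7 (p. 184), Remark 6.12 (2) (p. 188)] -/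
theorem tangentFormL_of_mem {x : stalkOrigin A} (hx : x ∈ maximalIdeal (stalkOrigin A)) :
    tangentFormL ψ x = ψ (Cotangent.mk A ⟨x, hx⟩) := by
  have h : dOrigin x = ⟨x, hx⟩ := by
    ext; rw [coe_dOrigin, evalOrigin_eq_zero_of_mem A hx, map_zero, sub_zero]
  rw [tangentFormL, h]

/-- `tangentFormL ψ` kills `𝔪_e²`.
[cite: GortzWedhorn2020, (6.4) and Proposition 6.7 (p. 184), Remark 6.12 (2) (p. 188)] -/
theorem tangentFormL_of_mem_sq {x : stalkOrigin A} (hx : x ∈ maximalIdeal (stalkOrigin A) ^ 2) :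
    tangentFormL ψ x = 0 := by
  rw [tangentFormL_of_mem ψ (Ideal.pow_le_self two_ne_zero hx),
    Cotangent.mk_eq_zero_iff.mpr hx, map_zero]

/-- The Leibniz rule: `ψ d(ab) = a(e) ψ db + b(e) ψ da`.
[cite: GortzWedhorn2020, (6.4) and Proposition 6.7 (p. 184), Remark 6.12 (2) (p. 188)] -/
theorem tangentFormL_mul (a b : stalkOrigin A) :
    tangentFormL ψ (a * b) =
      evalOrigin A a • tangentFormL ψ b + evalOrigin A b • tangentFormL ψ a := by
  set a' := a - stalkOriginAlgebraMap A (evalOrigin A a) with ha'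
  set b' := b - stalkOriginAlgebraMap A (evalOrigin A b) with hb'
  have hab : a * b = stalkOriginAlgebraMap A (evalOrigin A a * evalOrigin A b) +
      stalkOriginAlgebraMap A (evalOrigin A a) * b' +
      stalkOriginAlgebraMap A (evalOrigin A b) * a' + a' * b' := by
    rw [map_mul, ha', hb']; ring
  have h2 : tangentFormL ψ (a' * b') = 0 := tangentFormL_of_mem_sq ψ (by
    rw [pow_two]
    exact Ideal.mul_mem_mul (sub_algebraMap_evalOrigin_mem A a) (sub_algebraMap_evalOrigin_mem A b))
  have hb'' : tangentFormL ψ b' = tangentFormL ψ b := by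
    rw [hb', sub_eq_add_neg, tangentFormL_add, ← map_neg, tangentFormL_algebraMap, add_zero]
  have ha'' : tangentFormL ψ a' = tangentFormL ψ a := by
    rw [ha', sub_eq_add_neg, tangentFormL_add, ← map_neg, tangentFormL_algebraMap, add_zero]
  rw [hab, tangentFormL_add, tangentFormL_add, tangentFormL_add, tangentFormL_algebraMap,
    tangentFormL_smul, tangentFormL_smul, h2, hb'', ha'']
  simp only [zero_add, add_zero]

/-- **The `L`-valued tangent vector `a ↦ a(e) + ψ(da(e)) ε : 𝒪_{A,e} → L[ε]`** attached to a
`K`-linear map `ψ : T_e^*(A) → L` (Görtz–Wedhorn I, (6.4) and Remark 6.12 (2): `L[ε]`-valued points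
at `e`). [cite: GortzWedhorn2020, Remark 6.12 (2) (p. 188)] -/
def tangentHomL : stalkOrigin A →+* DualNumber L where
  toFun a := inl (algebraMap K L (evalOrigin A a)) + inr (tangentFormL ψ a)
  map_one' := by
    have h1 : tangentFormL ψ 1 = 0 := by
      rw [← map_one (stalkOriginAlgebraMap A)]; exact tangentFormL_algebraMap ψ 1
    rw [map_one, map_one, h1, inr_zero, add_zero]
    rfl
  map_mul' a b := by
    apply TrivSqZeroExt.ext
    · simp only [fst_add, fst_inl, fst_inr, add_zero, fst_mul, map_mul]
    · simp only [snd_add, snd_inl, snd_inr, zero_add, snd_mul, fst_add, fst_inl, fst_inr, add_zero,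
        smul_eq_mul, MulOpposite.smul_eq_mul_unop, MulOpposite.unop_op, tangentFormL_mul,
        Algebra.smul_def]
      ring
  map_zero' := by
    have h0 : tangentFormL ψ 0 = 0 := by
      rw [← map_zero (stalkOriginAlgebraMap A)]; exact tangentFormL_algebraMap ψ 0
    rw [map_zero, map_zero, h0, inl_zero, inr_zero, add_zero]
  map_add' a b := by
    rw [map_add, map_add, inl_add, tangentFormL_add, inr_add]
    abel

/-- Unfolding of `tangentHomL`.
[cite: GortzWedhorn2020, (6.4) and Proposition 6.7 (p. 184), Remark 6.12 (2) (p. 188)] -/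
theorem tangentHomL_apply (a : stalkOrigin A) :
    tangentHomL ψ a = inl (algebraMap K L (evalOrigin A a)) + inr (tangentFormL ψ a) := rfl

/-- The constant part of `tangentHomL ψ` is evaluation at the origin.
[cite: GortzWedhorn2020, (6.4) and Proposition 6.7 (p. 184), Remark 6.12 (2) (p. 188)] -/
theorem fst_tangentHomL_apply (a : stalkOrigin A) :
    (tangentHomL ψ a).fst = algebraMap K L (evalOrigin A a) := by
  rw [tangentHomL_apply, fst_add, fst_inl, fst_inr, add_zero]

/-- The `ε`-part of `tangentHomL ψ` is `tangentFormL ψ`.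
[cite: GortzWedhorn2020, (6.4) and Proposition 6.7 (p. 184), Remark 6.12 (2) (p. 188)] -/
theorem snd_tangentHomL_apply (a : stalkOrigin A) : (tangentHomL ψ a).snd = tangentFormL ψ a := by
  rw [tangentHomL_apply, snd_add, snd_inl, snd_inr, zero_add]

/-- `tangentHomL ψ` is local. [folklore] -/
instance isLocalHom_tangentHomL : IsLocalHom (tangentHomL ψ) :=
  ⟨fun a ha => by
    rw [isUnit_iff_isUnit_fst, fst_tangentHomL_apply, isUnit_iff_ne_zero, map_ne_zero,
      ← isUnit_iff_ne_zero] at ha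
    exact (isUnit_map_iff (evalOrigin A) a).mp ha⟩

end TangentL

end AbelianVariety
end Literature.AlgebraicGeometry.Motives
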